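import Summits.ResolutionOfSingularities.ResolutionOfSingularities.Theorems.RadicialJungCleanModelsGiraudStepPointTrichotomy
import Summits.ResolutionOfSingularities.ResolutionOfSingularities.Theorems.RadicialJungCleanModelsPBasisAdapted
import Summits.ResolutionOfSingularities.ResolutionOfSingularities.Theorems.RadicialJungCleanModelsT2BlowupStalkChartAtPrime
import Summits.ResolutionOfSingularities.ResolutionOfSingularities.Theorems.RadicialJungCleanModelsT2BlowupStalkChartLoc
import Summits.ResolutionOfSingularities.ResolutionOfSingularities.Theorems.RadicialJungCleanModelsT2KaehlerProjectiveTransport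
import Summits.ResolutionOfSingularities.ResolutionOfSingularities.Theorems.RadicialJungCleanModelsT2GiraudInvariantsTransport
import Literature.AlgebraicGeometry.Resolution.QuadraticTransformsChart
import HarnessLib

/-!
# Route `RadicialJung`, crux `CleanModels` (stmt-15917): Giraud's Lemme 2.3 at a point of the
# blow-up, STALK form on the chart of `x` (T2: `stub_lemma23`, chart-of-`x` case)

Support file (OURS) for PROGRAMME-clean-dim2 / T2, line `via-clean-models` of the crux
`DescentPerfectToAll` (stmt-0549). Nothing here is a statement of Hironaka's manuscript.

The per-chart algebra (`RadicialJungCleanModelsGiraudStepPointTrichotomy.lean`) transported to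
the stalks along res-D-pv-030's scheme→chart bridge (`…T2BlowupStalkChart*.lean`): for a blowing
up `π : X₁ → X` along `J` with `J_{π x′} = 𝔪` (point blow-up), `R = im(𝒪_{X,π x′}) ≤ T = im(ε_{x′})`
inside `K(X)`, `T` is the localisation of `R[v/u]` at `Q = 𝔪_T ∩ R[v/u]` when `R[v/u] ≤ T`; the
invariants `c` and the critical primes move along `𝒪 ≃ R`, `𝒪₁ ≃ T`
(`…T2GiraudInvariantsTransport.lean`). Inputs that stay hypotheses: a `p`-basis of
`𝒪_{X,π x′}` containing the regular parameters `u, v` (res-L0-w81-pv-2's discharge), and the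
explicit critical primes of the germs at the two points (geometry of `E(f₁) = π⁻¹E(f)`).

* `derivation_mapsTo_range_stalkEmb` — the chart hypothesis `hT` (derivation stability of `T`);
* `giraudColength_lt_of_chart_stalk` — **on the chart of `u`: `c(X₁, π^*f, x′) < c(X, f, π x′)`**.

References: J. Giraud, Bull. SMF 111 (1983), Lemme 2.3 [Giraud1983].
-/

noncomputable section

set_option linter.dupNamespace false -- mandated namespace of this single-conjunct summit

open CategoryTheory AlgebraicGeometry TopologicalSpace IsLocalRing
open Literature.RingTheory.PBasis Literature.AlgebraicGeometry.Resolution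
open Summit.ResolutionOfSingularities.ResolutionOfSingularities.Theorems.RadicialJung.CleanModels.T2

namespace Summit.ResolutionOfSingularities.ResolutionOfSingularities.Theorems.RadicialJung.CleanModels

open Scheme.IdealSheafData

/-! ## Derivation stability of a localisation of a chart ring inside `K` -/

/-- If `A ≤ T ⊆ K` are subrings, every element of `T` is `a/s` with `a, s ∈ A`, `s` a unit of `T`,
and the derivation `D` of `K` maps `A` into `T`, then `D` maps `T` into `T`. [folklore] -/
theorem derivation_mapsTo_of_fractions {K : Type*} [Field K] {A T : Subring K} (hAT : A ≤ T)
    (hfrac : ∀ t : T, ∃ a s : A, IsUnit (Subring.inclusion hAT s) ∧ (t : K) * s = a)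
    (D : Derivation ℤ K K) (hD : ∀ a : A, D a ∈ T) : ∀ t : T, D t ∈ T := by
  intro t
  obtain ⟨a, s, hsu, hts⟩ := hfrac t
  have hs0 : ((s : A) : K) ≠ 0 := by
    intro h0
    have : Subring.inclusion hAT s = 0 := Subtype.ext h0
    exact hsu.ne_zero this
  have ht : (t : K) = (a : K) / s := by rw [eq_div_iff hs0, hts]
  obtain ⟨w, hw⟩ := hsu.exists_left_inv
  have hwK : ((w : T) : K) * s = 1 := by
    have := congrArg (fun z : T => (z : K)) hw
    simpa using this
  have hinv : ((s : A) : K)⁻¹ = (w : K) := inv_eq_of_mul_eq_one_left hwK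
  rw [ht, Derivation.leibniz_div, hinv, smul_eq_mul, smul_eq_mul, smul_eq_mul]
  exact T.mul_mem (T.pow_mem w.2 2)
    (T.sub_mem (T.mul_mem (hAT s.2) (hD a)) (T.mul_mem (hAT a.2) (hD s)))

/-! ## The chart of `u`, stalk form -/

section Stalk

variable {X₁ X : Scheme.{0}} [IsIntegral X] [IsLocallyNoetherian X] {π : X₁ ⟶ X}
  {J : X.IdealSheafData}

/-- **Lemme 2.3 on the chart of `u`, stalk form: `c(X₁, π^* f, x′) < c(X, f, π x′)`.** For the
blow-up `π` along `J` with `J_{π x′} = 𝔪`, regular parameters `(u, v)` of the two-dimensional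
regular stalk `𝒪_{X,π x′}` lying in a `p`-basis `Γ₀`, `Ω` projective, `x′` on the chart of `u`
(`R[v/u] ≤ T`) with `𝒪_{X₁,x′}` of dimension `2`, a germ `f₀ ∉ 𝒪^p` with `c ≠ 0`, and critical
primes EITHER `{(u)}` at `π x′` and `{(π^♯u)}` at `x′` (non-crossing) OR `{(u), (v)}` at `π x′` and
the non-units among `(π^♯u), (w)` at `x′`, `ε(w) = v/u` (crossing).
[cite: Giraud1983, Lemme 2.3 (i)–(iii)] -/
theorem giraudColength_lt_of_chart_stalk (hπ : IsBlowup π J) (x' : X₁)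
    (hJ : stalkIdeal J (π x') = maximalIdeal (X.presheaf.stalk (π x')))
    [IsRegularLocalRing (X.presheaf.stalk (π x'))]
    (hdim : ringKrullDim (X.presheaf.stalk (π x')) = 2)
    (hdim₁ : ringKrullDim (X₁.presheaf.stalk x') = 2)
    {p : ℕ} [Fact p.Prime] [CharP (X.presheaf.stalk (π x')) p]
    [Module.Projective (X.presheaf.stalk (π x')) Ω[X.presheaf.stalk (π x')⁄ℤ]]
    (u v : X.presheaf.stalk (π x')) (huv : maximalIdeal (X.presheaf.stalk (π x')) = Ideal.span {u, v})
    (hne : u ≠ v) {Γ₀ : Set (X.presheaf.stalk (π x'))}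
    (hΓ₀ : IsPBasisOver p (frobenius (X.presheaf.stalk (π x')) p).range Γ₀) (huΓ : u ∈ Γ₀)
    (hvΓ : v ∈ Γ₀)
    (hle : haveI := isLocalRing_range_algebraMap_stalk (X := X) (π x')
      chartAdjoin (K := X.functionField)
        (⟨algebraMap _ X.functionField u, u, rfl⟩ :
          (algebraMap (X.presheaf.stalk (π x')) X.functionField).range)
        ⟨algebraMap _ X.functionField v, v, rfl⟩ ≤ (hπ.stalkEmb x').range)
    (f₀ : X.presheaf.stalk (π x')) (hf : f₀ ∉ (frobenius (X.presheaf.stalk (π x')) p).range)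
    (hc : giraudColength (X.presheaf.stalk (π x')) f₀ ≠ 0)
    (w : X₁.presheaf.stalk x')
    (hw : hπ.stalkEmb x' w = algebraMap _ X.functionField v / algebraMap _ X.functionField u)
    (hcase : ((∀ P, P ∈ derivCriticalPrimes (X.presheaf.stalk (π x')) f₀ ↔ P = Ideal.span {u}) ∧
        (∀ P, P ∈ derivCriticalPrimes (X₁.presheaf.stalk x') ((π.stalkMap x').hom f₀) ↔
          P = Ideal.span {(π.stalkMap x').hom u})) ∨
      ((∀ P, P ∈ derivCriticalPrimes (X.presheaf.stalk (π x')) f₀ ↔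
          (P = Ideal.span {u} ∨ P = Ideal.span {v})) ∧
        (∀ P, P ∈ derivCriticalPrimes (X₁.presheaf.stalk x') ((π.stalkMap x').hom f₀) ↔
          ((¬ IsUnit ((π.stalkMap x').hom u) ∧ P = Ideal.span {(π.stalkMap x').hom u}) ∨
            (¬ IsUnit w ∧ P = Ideal.span {w}))))) :
    giraudColength (X₁.presheaf.stalk x') ((π.stalkMap x').hom f₀) <
      giraudColength (X.presheaf.stalk (π x')) f₀ := by
  classical
  haveI hRloc := isLocalRing_range_algebraMap_stalk (X := X) (π x')
  haveI hTloc := isLocalRing_range_stalkEmb hπ x'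
  set K := X.functionField
  set R : Subring K := (algebraMap (X.presheaf.stalk (π x')) K).range with hRdef
  set T : Subring K := (hπ.stalkEmb x').range with hTdef
  obtain ⟨e₀, he₀⟩ := exists_ringEquiv_range_stalk (X := X) (π := π) x'
  obtain ⟨e₁, he₁⟩ := exists_ringEquiv_range_stalkEmb hπ x'
  -- the elements
  set x : R := ⟨algebraMap _ K u, u, rfl⟩ with hxdef
  set y : R := ⟨algebraMap _ K v, v, rfl⟩ with hydef
  have he₀u : e₀ u = x := Subtype.ext (he₀ u)
  have he₀v : e₀ v = y := Subtype.ext (he₀ v)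
  have hRT : R ≤ T := range_algebraMap_le_range_stalkEmb hπ x'
  have he₁_of : ∀ a : X.presheaf.stalk (π x'),
      e₁ ((π.stalkMap x').hom a) = Subring.inclusion hRT (e₀ a) := by
    intro a
    apply Subtype.ext
    rw [he₁, Subring.coe_inclusion, he₀, hπ.stalkEmb_stalkMap]
  -- instances and data on `R`
  haveI : IsRegularLocalRing R := IsRegularLocalRing.of_ringEquiv e₀
  have hdimR : ringKrullDim R = 2 := by rw [← ringKrullDim_eq_of_ringEquiv e₀]; exact hdim
  haveI : CharP R p := charP_of_injective_ringHom (f := (e₀ : X.presheaf.stalk (π x') →+* R))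
    e₀.injective p
  haveI : Module.Projective R Ω[R⁄ℤ] := projective_kaehler_range_stalk (X := X) (π x')
  haveI : IsFractionRing R K := isFractionRing_range_stalk (X := X) (π x')
  have hm : maximalIdeal R = Ideal.span {x, y} := maximalIdeal_range_eq_span_pair (π := π) x' u v huv
  have hxy : x ≠ y := fun h => hne (e₀.injective (by rw [he₀u, he₀v, h]))
  have hx0 : x ≠ 0 := fun h => fst_not_mem_sq hdimR hm (by rw [h]; exact Ideal.zero_mem _)
  have hu0 : u ≠ 0 := fun h => hx0 (by rw [← he₀u, h, map_zero])
  have hx0K : ((x : R) : K) ≠ 0 := fun h => hx0 (Subtype.ext h)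
  have hum : u ∈ maximalIdeal (X.presheaf.stalk (π x')) := huv ▸ Ideal.subset_span (by simp)
  -- the `p`-basis on `R` and its dual derivations
  have hΓ : IsPBasisOver p (frobenius R p).range (e₀ '' Γ₀) := IsPBasisOver.map_ringEquiv e₀ hΓ₀
  have hxΓ : x ∈ e₀ '' Γ₀ := ⟨u, huΓ, he₀u⟩
  have hyΓ : y ∈ e₀ '' Γ₀ := ⟨v, hvΓ, he₀v⟩
  obtain ⟨δ, hδ₁, hδ₀⟩ := IsPBasisOver.exists_dual_derivations hΓ
  -- the chart structure on `T`
  letI : Algebra (chartAdjoin (K := K) x y) T := (Subring.inclusion hle).toAlgebra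
  have halgT : algebraMap (chartAdjoin (K := K) x y) T = Subring.inclusion hle := rfl
  haveI := isLocalization_atPrime_range_stalkEmb hπ x' hJ u v huv hu0 hle
  set Q : Ideal (chartAdjoin (K := K) x y) := (maximalIdeal T).comap (Subring.inclusion hle) with hQ
  haveI : Q.IsMaximal := isMaximal_comap_maximalIdeal_chartAdjoin hπ x' hJ u v huv hu0 hdim hdim₁ hle
  have hxQ : chartIncl x y x ∈ Q := chartIncl_mem_comap_maximalIdeal hπ x' u v hle hum
  have hyxT : ((y : R) : K) / x ∈ T := hle (Algebra.subset_adjoin (Set.mem_singleton _))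
  -- derivation stability of `T`
  have hTeq := range_stalkEmb_eq_ofPrime_chartAdjoin hπ x' hJ u v huv hu0 hle
  have hT : ∀ D : Derivation ℤ K K, (∀ r : R, D r ∈ R) → D (((y : R) : K) / x) ∈ T →
      ∀ t : T, D t ∈ T := by
    intro D hDR hDyx
    -- `D` maps the chart ring into `T`
    have hDA : ∀ a : chartAdjoin (K := K) x y, D a ∈ T := by
      intro a
      have ha : (a : K) ∈ Algebra.adjoin R {((y : R) : K) / x} := a.2
      refine Algebra.adjoin_induction (p := fun z _ => D z ∈ T) ?_ ?_ ?_ ?_ ha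
      · intro t ht; rw [Set.mem_singleton_iff] at ht; rw [ht]; exact hDyx
      · intro r; exact hRT (hDR r)
      · intro b c _ _ ihb ihc; rw [map_add]; exact T.add_mem ihb ihc
      · intro b c hb hc ihb ihc
        rw [Derivation.leibniz, smul_eq_mul, smul_eq_mul]
        exact T.add_mem (T.mul_mem (hle hb) ihc) (T.mul_mem (hle hc) ihb)
    refine derivation_mapsTo_of_fractions hle (fun t => ?_) D hDA
    have ht : (t : K) ∈ (LocalSubring.ofPrime (chartAdjoin (K := K) x y) Q).toSubring := by
      rw [← hTeq]; exact t.2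
    obtain ⟨a, s, hsQ, hts⟩ := (mem_ofPrime_iff (A := chartAdjoin (K := K) x y) (P := Q)).mp ht
    refine ⟨a, s, ?_, ?_⟩
    · -- `s ∉ Q = 𝔪_T ∩ A`: a unit of `T`
      by_contra hsu
      exact hsQ ((mem_maximalIdeal _).mpr hsu)
    · have hs0 : ((s : chartAdjoin (K := K) x y) : K) ≠ 0 := by
        intro h0
        apply hsQ
        have : s = 0 := Subtype.ext h0
        rw [this]; exact Q.zero_mem
      rw [hts, div_mul_cancel₀ _ hs0]
  -- the germ and its invariants on `R`
  have hfR : e₀ f₀ ∉ (frobenius R p).range := by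
    rintro ⟨r, hr⟩
    apply hf
    refine ⟨e₀.symm r, ?_⟩
    apply e₀.injective
    rw [frobenius_def, map_pow, RingEquiv.apply_symm_apply, ← frobenius_def, hr]
  have hcR : giraudColength R (e₀ f₀) ≠ 0 := by rwa [giraudColength_ringEquiv e₀ f₀]
  -- transport of the critical primes
  have hcritR₀ := derivCriticalPrimes_ringEquiv e₀ f₀
  have hcritT₀ := derivCriticalPrimes_ringEquiv e₁ ((π.stalkMap x').hom f₀)
  have hf₁ : e₁ ((π.stalkMap x').hom f₀) = Subring.inclusion hRT (e₀ f₀) := he₁_of f₀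
  have hu₁ : e₁ ((π.stalkMap x').hom u) = Subring.inclusion hRT x := by rw [he₁_of u, he₀u]
  have hw₁ : e₁ w = ⟨((y : R) : K) / x, hyxT⟩ := Subtype.ext (by rw [he₁, hw])
  have hmap₀ : ∀ a, Ideal.map e₀ (Ideal.span {a}) = Ideal.span {e₀ a} := fun a => by
    rw [Ideal.map_span, Set.image_singleton]
  have hmap₁ : ∀ a, Ideal.map e₁ (Ideal.span {a}) = Ideal.span {e₁ a} := fun a => by
    rw [Ideal.map_span, Set.image_singleton]
  have hlt : giraudColength T (Subring.inclusion hRT (e₀ f₀)) < giraudColength R (e₀ f₀) := by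
    refine giraudColength_lt_of_chart δ hδ₁ hδ₀ hxΓ hyΓ hdimR hm hxy hΓ hRT hle hyxT hT halgT Q hxQ
      (e₀ f₀) hfR hcR ?_
    rcases hcase with ⟨h0, h1⟩ | ⟨h0, h1⟩
    · left
      constructor
      · intro P
        rw [hcritR₀, Set.mem_image]
        constructor
        · rintro ⟨P₀, hP₀, rfl⟩
          rw [(h0 P₀).mp hP₀, hmap₀, he₀u]
        · intro hP
          refine ⟨Ideal.span {u}, (h0 _).mpr rfl, ?_⟩
          rw [hmap₀, he₀u, hP]
      · intro P
        rw [← hf₁, hcritT₀, Set.mem_image]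
        constructor
        · rintro ⟨P₀, hP₀, rfl⟩
          rw [(h1 P₀).mp hP₀, hmap₁, hu₁]
        · intro hP
          refine ⟨Ideal.span {(π.stalkMap x').hom u}, (h1 _).mpr rfl, ?_⟩
          rw [hmap₁, hu₁, hP]
    · right
      constructor
      · intro P
        rw [hcritR₀, Set.mem_image]
        constructor
        · rintro ⟨P₀, hP₀, rfl⟩
          rcases (h0 P₀).mp hP₀ with hP₀' | hP₀'
          · left; rw [hP₀', hmap₀, he₀u]
          · right; rw [hP₀', hmap₀, he₀v]
        · rintro (hP | hP)
          · exact ⟨Ideal.span {u}, (h0 _).mpr (Or.inl rfl), by rw [hmap₀, he₀u, hP]⟩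
          · exact ⟨Ideal.span {v}, (h0 _).mpr (Or.inr rfl), by rw [hmap₀, he₀v, hP]⟩
      · intro P
        rw [← hf₁, hcritT₀, Set.mem_image]
        have hunit_u : IsUnit ((π.stalkMap x').hom u) ↔ IsUnit (Subring.inclusion hRT x) := by
          rw [← hu₁]; exact (isUnit_map_iff e₁ _).symm
        have hunit_w : IsUnit w ↔ IsUnit (⟨((y : R) : K) / x, hyxT⟩ : T) := by
          rw [← hw₁]; exact (isUnit_map_iff e₁ _).symm
        constructor
        · rintro ⟨P₀, hP₀, rfl⟩
          rcases (h1 P₀).mp hP₀ with ⟨hnu, hP₀'⟩ | ⟨hnu, hP₀'⟩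
          · left; exact ⟨fun h => hnu (hunit_u.mpr h), by rw [hP₀', hmap₁, hu₁]⟩
          · right; exact ⟨fun h => hnu (hunit_w.mpr h), by rw [hP₀', hmap₁, hw₁]⟩
        · rintro (⟨hnu, hP⟩ | ⟨hnu, hP⟩)
          · exact ⟨Ideal.span {(π.stalkMap x').hom u}, (h1 _).mpr (Or.inl ⟨fun h => hnu (hunit_u.mp h), rfl⟩),
              by rw [hmap₁, hu₁, hP]⟩
          · exact ⟨Ideal.span {w}, (h1 _).mpr (Or.inr ⟨fun h => hnu (hunit_w.mp h), rfl⟩),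
              by rw [hmap₁, hw₁, hP]⟩
  -- back to the stalks
  rw [← giraudColength_ringEquiv e₁ ((π.stalkMap x').hom f₀), ← giraudColength_ringEquiv e₀ f₀, hf₁]
  exact hlt

end Stalk

end Summit.ResolutionOfSingularities.ResolutionOfSingularities.Theorems.RadicialJung.CleanModels

end
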